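import Summits.CriticalPhenomena.PercolationContinuityZ3.Theorems.PercNearOneGluingNoHeavyLowerTailMajorityGluingQCertSym3SixFourBP1
import Summits.CriticalPhenomena.PercolationContinuityZ3.Theorems.PercNearOneGluingNoHeavyLowerTailMajorityGluingQCertSym3SixFourBP2
import Summits.CriticalPhenomena.PercolationContinuityZ3.Theorems.PercNearOneGluingNoHeavyLowerTailMajorityGluingQCertSym3SixFourBP3
import HarnessLib

/-!
# The degree-3 orbit certificate of the cell `(6,4)` at `c = 113/100`, glued from 3 parts (lane prim-rate, constants-miner 1, gen 36; generated by cert/mksym3.py)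

Support file for the closed crux `NoHeavyLowerTail` (stmt-CriticalPhenomena-4575), majority-gluing line.  A SYMMETRISED DEGREE-3 certificate
(`…MajorityGluingQCertSym3`) for «at least 4 of 6 relays cut»: `μ(4 ≤ #cut) ≤ (113/100)·δ`, found by the S_6-symmetrised degree-3 moment LP of the cell
(kit j288186: symlp3.py — TRIPLE-orbit pseudo-moments; all hub-rooted van den Berg–Kahn row orbits × lift variables and `2×2` square orbits × lift variables separated
exhaustively up to symmetry; chain-free; exact integer multipliers; re-verified in the Lean semantics of `SymCert3.checkQ3S` by cert/mksym3.py: 12239 contributions in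
386 cubic orbit keys, all key sums `≥ 0`).  ONE representative per orbit: 60 rows×lift, 52 squares×lift, 85 marginal slacks, 46 multiplier terms.
Split into 3 parts (`…QCertSym3SixFourBP1 … P3`); here glued (`SymCert3.concat`), structure check + run check of the glued digests by the kernel, and `sixFourSym3b_pos`
(`SymCert3.pos_of_digests3`) for `SymCert3.cut_of_posS3_count`.  No sorries. [cite: VandenbergKahn2001, Thm 1.2 (p. 123)]
-/

namespace Summit.CriticalPhenomena.PercolationContinuityZ3.Theorems

namespace HubOnly
namespace QCert

/-- The cell parameters `(6,4)`, `c = 113/100`. -/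
def sixFourSym3bBase : Cert := ⟨6, 4, 113, 100, 1, [], [], []⟩

/-- **The degree-3 orbit certificate of `(6,4)` at `c = 113/100`**, glued from its parts. -/
def sixFourSym3b : SymCert3 := SymCert3.concat sixFourSym3bBase [sixFourSym3bP1, sixFourSym3bP2, sixFourSym3bP3]

/-- All parts carry the cell parameters. -/
theorem sixFourSym3b_bases : ∀ d ∈ [sixFourSym3bP1, sixFourSym3bP2, sixFourSym3bP3], d.base = sixFourSym3bBase := by
  intro d hd
  simp only [List.mem_cons, List.mem_nil_iff, or_false] at hd
  rcases hd with rfl | rfl | rfl <;> rfl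

/-- The base of the glued certificate. -/
theorem sixFourSym3b_base : sixFourSym3b.base = sixFourSym3bBase := SymCert3.concat_base _ _ sixFourSym3b_bases

/-- Its number of relays. -/
theorem sixFourSym3b_m : sixFourSym3b.base.m = 6 := by
  rw [sixFourSym3b_base]; rfl

/-- The parts' digests. -/
theorem sixFourSym3b_digests : List.Forall₂ (fun d dg => d.digest3 20 = dg) [sixFourSym3bP1, sixFourSym3bP2, sixFourSym3bP3] [sixFourSym3bP1D, sixFourSym3bP2D, sixFourSym3bP3D] :=
  List.Forall₂.cons sixFourSym3bP1_digest (List.Forall₂.cons sixFourSym3bP2_digest (List.Forall₂.cons sixFourSym3bP3_digest (List.Forall₂.nil)))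

/-- **The glued digests pass the run check.** -/
theorem sixFourSym3b_runs : runsOK (msort2 20 [sixFourSym3bP1D, sixFourSym3bP2D, sixFourSym3bP3D].flatten) = true := by
  decide +kernel

/-- **The structure check of the glued certificate.** -/
theorem sixFourSym3b_checkWS : sixFourSym3b.checkW3S = true := by
  decide +kernel

/-- **The whole contribution list evaluates nonnegatively at every nonnegative key valuation.** -/
theorem sixFourSym3b_pos : ∀ val : ℕ → ℝ, (∀ key, 0 ≤ val key) → 0 ≤ evalC val sixFourSym3b.contribs3S :=
  SymCert3.pos_of_digests3 sixFourSym3bBase [sixFourSym3bP1, sixFourSym3bP2, sixFourSym3bP3] sixFourSym3b_bases 20 [sixFourSym3bP1D, sixFourSym3bP2D, sixFourSym3bP3D] sixFourSym3b_digests sixFourSym3b_runs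

end QCert
end HubOnly

end Summit.CriticalPhenomena.PercolationContinuityZ3.Theorems
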